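import Literature.Probability.RandomPlanarGeometry.PlanarDomains
import Literature.Topology.PlaneTopology.Crosscut
import HarnessLib

/-!
# The parameter modulus of a Dobrushin domain
# (piece (K4m) of stub 5a4″ `stub_carvedReduction_squeezeSolid`)

Piece of stub 5a4″ `stub_carvedReduction_squeezeSolid`
(`TwoPieceAdmRestrictionLimit → MovingCarvingSqueezeP FatAnchoredClassZeroSolid`) of the line
`bridge-gate-renewal` (r11) of the crux `SAWDefectDecoherence.ObservableToSLER`
(stmt-CriticalPhenomena-14005; twin T-A `stub_carvedReduction_squeezeGeometry` of
stmt-CriticalPhenomena-10472), serving hypotheses (H1)/(H2) of the repaired inner-approximant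
contract `InnerApproximant2` for its CONSUMER.

* `stub_carvedReduction_paramModulus` — for a Dobrushin domain `D` (boundary loop `D.boundary`,
  continuous, `1`-periodic, injective on a period; marks `0 ≤ D.mark 0 < D.mark 1 < 1`) and every
  `ε > 0`: a parameter window `s > 0` separating the two marks cyclically
  (`D.mark 0 + s < D.mark 1 - s`, `D.mark 1 + s < D.mark 0 + 1 - s`) such that parameters
  `s`-near a mark are mapped `ε`-near the marked point (continuity of the loop at the two marks),
  together with a radius `r₀ > 0` such that every parameter whose boundary point is `r₀`-near a
  marked point is `s`-near its mark modulo `1` (injectivity of the loop on the period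
  `[D.mark i, D.mark i + 1)` and compactness of the far parameter interval
  `[D.mark i + s, D.mark i + 1 - s]`, on which `t ↦ dist (D.boundary t) (D.pt i)` is continuous and
  positive, hence bounded below by a positive constant).

Sources: Ch. Pommerenke, Boundary Behaviour of Conformal Maps (1992), §2.2 (Jordan domains and
their boundary parametrisations); the statement itself is elementary point-set topology.
-/

noncomputable section
open Set Metric Function
open Literature.Probability.RandomPlanarGeometry

namespace Summit.CriticalPhenomena.SAWScalingLimit.Theorems.ObservableToSLER.Squeeze

/-! ### Near parameters are mapped near the marked points -/

/-- Continuity of the boundary loop at the two marks, with ONE window `δ` for both marks: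
`|t - D.mark i| < δ → dist (D.boundary t) (D.pt i) < ε`. [folklore] -/
private theorem paramModulus_exists_window (D : DobrushinDomain) {ε : ℝ} (hε : 0 < ε) :
    ∃ δ > (0 : ℝ), ∀ i : Fin 2, ∀ t : ℝ, |t - D.mark i| < δ →
      dist (D.boundary t) (D.pt i) < ε := by
  have h : ∀ i : Fin 2, ∃ δ > (0 : ℝ), ∀ t : ℝ, |t - D.mark i| < δ →
      dist (D.boundary t) (D.pt i) < ε := fun i => by
    obtain ⟨δ, hδ, hδε⟩ := Metric.continuous_iff.1 D.continuous_boundary (D.mark i) ε hε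
    exact ⟨δ, hδ, fun t ht => hδε t (by rwa [Real.dist_eq])⟩
  obtain ⟨δ₀, hδ₀, h₀⟩ := h 0
  obtain ⟨δ₁, hδ₁, h₁⟩ := h 1
  refine ⟨min δ₀ δ₁, lt_min hδ₀ hδ₁, Fin.forall_fin_two.2 ⟨fun t ht => ?_, fun t ht => ?_⟩⟩
  · exact h₀ t (ht.trans_le (min_le_left _ _))
  · exact h₁ t (ht.trans_le (min_le_right _ _))

/-! ### Boundary points near a marked point have parameters near its mark modulo `1` -/

/-- The injectivity radius at ONE mark: for every window `s > 0` there is `r > 0` such that a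
parameter whose boundary point is `r`-near `D.pt i` is `s`-near `D.mark i` modulo `1`.  Proof: on
the compact far interval `[D.mark i + s, D.mark i + 1 - s]` (inside the period
`[D.mark i, D.mark i + 1)`, on which the loop is injective) the continuous function
`t ↦ dist (D.boundary t) (D.pt i)` is positive, hence `≥ m > 0`; take `r := m / 2` and reduce a
given parameter into the period by an integer shift. [folklore] -/
private theorem paramModulus_exists_radius (D : DobrushinDomain) (i : Fin 2) {s : ℝ}
    (hs : 0 < s) :
    ∃ r > (0 : ℝ), ∀ t : ℝ, dist (D.boundary t) (D.pt i) ≤ r →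
      ∃ n : ℤ, |t - D.mark i - n| < s := by
  set a : ℝ := D.mark i with ha
  set f : ℝ → ℝ := fun t => dist (D.boundary t) (D.pt i) with hf
  have hfc : Continuous f := D.continuous_boundary.dist continuous_const
  have hpos : ∀ b ∈ Icc (a + s) (a + 1 - s), 0 < f b := by
    intro b hb
    refine dist_pos.2 fun heq => ?_
    have hbI : b ∈ Ico a (a + 1) := ⟨by linarith [hb.1], by linarith [hb.2]⟩
    have haI : a ∈ Ico a (a + 1) := ⟨le_rfl, by linarith⟩
    have hba : b = a := D.injOn_boundary_Ico a hbI haI heq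
    linarith [hb.1]
  obtain ⟨m, hm, hmf⟩ := isCompact_Icc.exists_forall_le' hfc.continuousOn hpos
  refine ⟨m / 2, half_pos hm, fun t ht => ?_⟩
  -- reduce `t` into the period `[a, a + 1)` by the integer shift `n = ⌊t - a⌋`
  set n : ℤ := ⌊t - a⌋ with hn
  have hv0 : (n : ℝ) ≤ t - a := Int.floor_le (t - a)
  have hv1 : t - a < n + 1 := Int.lt_floor_add_one (t - a)
  have hper : D.boundary (t - n) = D.boundary t := by
    simpa using D.periodic_boundary.sub_int_mul_eq (x := t) n
  have hft : f (t - n) < m := by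
    show dist (D.boundary (t - n)) (D.pt i) < m
    rw [hper]
    linarith
  have hnot : t - (n : ℝ) ∉ Icc (a + s) (a + 1 - s) := fun hmem => (hmf _ hmem).not_gt hft
  rw [mem_Icc, not_and_or, not_le, not_le] at hnot
  rcases hnot with h | h
  · exact ⟨n, abs_lt.2 ⟨by linarith, by linarith⟩⟩
  · exact ⟨n + 1, by push_cast; exact abs_lt.2 ⟨by linarith, by linarith⟩⟩

/-! ### The parameter modulus -/

/-- **Registered sub-goal `stub_carvedReduction_paramModulus`** (crux item stmt-CriticalPhenomena-14005,
stub 5a4″ `stub_carvedReduction_squeezeSolid`, piece (K4m) THE PARAMETER MODULUS): for every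
Dobrushin domain `D` and `ε > 0` there is a parameter window `s > 0` separating the two marks
cyclically (`D.mark 0 + s < D.mark 1 - s`, `D.mark 1 + s < D.mark 0 + 1 - s`) with parameters
`s`-near a mark mapped `ε`-near the marked point, and a radius `r₀ > 0` such that every parameter
whose boundary point is `r₀`-near a marked point is `s`-near its mark modulo `1`.  The T-A assembly
takes `ε := η / 3` and `2 rs ≤ r₀` to serve (H1), (H2) of `InnerApproximant2`. [folklore] -/
theorem stub_carvedReduction_paramModulus :
    ∀ (D : DobrushinDomain) (ε : ℝ), 0 < ε →
      ∃ s > (0 : ℝ), D.mark 0 + s < D.mark 1 - s ∧ D.mark 1 + s < D.mark 0 + 1 - s ∧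
        (∀ i : Fin 2, ∀ t : ℝ, |t - D.mark i| ≤ s → dist (D.boundary t) (D.pt i) < ε) ∧
        ∃ r₀ > (0 : ℝ), ∀ i : Fin 2, ∀ t : ℝ, dist (D.boundary t) (D.pt i) ≤ r₀ →
          ∃ n : ℤ, |t - D.mark i - n| < s := by
  intro D ε hε
  obtain ⟨δ, hδ, hδε⟩ := paramModulus_exists_window D hε
  have h01 : D.mark 0 < D.mark 1 := D.strictMono_mark (show (0 : Fin 2) < 1 by decide)
  have h0 : 0 ≤ D.mark 0 := (D.mark_mem 0).1
  have h1 : D.mark 1 < 1 := (D.mark_mem 1).2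
  -- the cyclic gaps between the marks and the window
  set g : ℝ := min (D.mark 1 - D.mark 0) (D.mark 0 + 1 - D.mark 1) with hg
  have hgpos : 0 < g := lt_min (by linarith) (by linarith)
  have hg1 : g ≤ D.mark 1 - D.mark 0 := min_le_left _ _
  have hg2 : g ≤ D.mark 0 + 1 - D.mark 1 := min_le_right _ _
  set s : ℝ := min (δ / 2) (g / 4) with hs
  have hspos : 0 < s := lt_min (half_pos hδ) (by linarith)
  have hsδ : s < δ := (min_le_left _ _).trans_lt (half_lt_self hδ)
  have hsg : s ≤ g / 4 := min_le_right _ _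
  -- the injectivity radii at the two marks
  obtain ⟨r₀', hr₀', hr₀⟩ := paramModulus_exists_radius D 0 hspos
  obtain ⟨r₁', hr₁', hr₁⟩ := paramModulus_exists_radius D 1 hspos
  refine ⟨s, hspos, by linarith, by linarith, fun i t ht => hδε i t (ht.trans_lt hsδ),
    min r₀' r₁', lt_min hr₀' hr₁', Fin.forall_fin_two.2 ⟨fun t ht => ?_, fun t ht => ?_⟩⟩
  · exact hr₀ t (ht.trans (min_le_left _ _))
  · exact hr₁ t (ht.trans (min_le_right _ _))

end Summit.CriticalPhenomena.SAWScalingLimit.Theorems.ObservableToSLER.Squeeze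

end
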